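import Mathlib
import HarnessLib
import Summits.NavierStokesRegularity.NavierStokesRegularity.Theses.LoopPeriodRatchet

/-!
# Route `LoopPeriodRatchet`, support `NoLoopsOfGrowth` (stmt-NavierStokesRegularity-27894) — proved

Statement: `FrequencyGrowthExponent → PeriodScalingBound →` every e₃-poloidal Type-I Oseen-mild ancient profile has no closed
vortex line carrying vorticity at any `s < 0`: every periodic orbit `γ` (period `ℓ > 0`) of the frozen-slice ODE `y′ = curl v(s)(y)` is
stationary, `curl v(s)(γ 0) = 0`.

Proof (the transplant the item asks for, from `Cruxes/PoloidalWindowRigidity/Lines/thread_axis.lean`, v5/v7, ns-idea-8): a loop at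
`s` with period `ℓ` forces loops at all `s₀ ≤ s` with periods `≤ A ℓ ((−s₀)/(−s))^κ` (`FrequencyGrowthExponent`), while the Yorke ×
Type-I floor gives periods `≥ c₀ (−s₀)^{3/2}`, `c₀ = 1 / max M 1` (read off the HYPOTHESIS `PeriodScalingBound`: `ℓ⁻¹ ≤ M(−s₀)^{−3/2}`);
`κ < 3/2` is a contradiction as `s₀ → −∞` — the pure-real-analysis engine `noOrbit_of_floor_and_growth` (verbatim from the workfile,
kernel-checked there).

HONEST FRAMING: a conditional support item of a door route (both hypotheses are route items: the open crux `FrequencyGrowthExponent`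
and the proved `PeriodScalingBound`); nothing here bears on `PoloidalWindowDoor.Target` or on Navier–Stokes regularity.
-/

noncomputable section

-- the summit and its single sub-problem share the name (CONVENTIONS §1), as in every Theorems file
set_option linter.dupNamespace false

namespace Summit.NavierStokesRegularity.NavierStokesRegularity.Theorems.LoopPeriodRatchetNoLoopsOfGrowth

open Filter Topology
open Summit.NavierStokesRegularity.NavierStokesRegularity.Theses.LoopPeriodRatchet

/-- **ENGINE (pure real analysis): a PERIOD FLOOR `c₀(−t)^{3/2} ≤ T` and a backward GROWTH EXPONENT `κ < 3/2` are incompatible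
with the existence of any orbit.**  `P t T` = «at time `t` there is an admissible orbit of period `T`».  From an orbit at `t` one gets
orbits at all `t₀ = −s ≤ t` with `c₀ s^{3/2} ≤ T₀ ≤ A T (s/(−t))^κ`, i.e. `c₀ s^{3/2−κ} ≤ A T (−t)^{−κ}` for all large `s` — absurd since
`s^{3/2−κ} → ∞`.  (Verbatim from the crux workfile `Cruxes/PoloidalWindowRigidity/Lines/thread_axis.lean`, ns-idea-8.) [folklore] -/
theorem noOrbit_of_floor_and_growth {P : ℝ → ℝ → Prop} (c₀ A κ : ℝ) (hc₀ : 0 < c₀) (hA : 0 < A) (hκ : κ < 3 / 2)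
    (hY : ∀ t < 0, ∀ T, P t T → c₀ * (-t) ^ ((3 : ℝ) / 2) ≤ T)
    (hG : ∀ t₀ t : ℝ, t₀ ≤ t → t < 0 → ∀ T, P t T → ∃ T₀, P t₀ T₀ ∧ T₀ ≤ A * T * ((-t₀) / (-t)) ^ κ) :
    ∀ t < 0, ∀ T, ¬ P t T := by
  intro t ht T hP
  have hpos : 0 < (3 : ℝ) / 2 - κ := by linarith
  set B : ℝ := A * T / (-t) ^ κ with hB
  have hev : ∀ᶠ s : ℝ in atTop, B / c₀ + 1 ≤ s ^ ((3 : ℝ) / 2 - κ) := (tendsto_rpow_atTop hpos).eventually_ge_atTop _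
  obtain ⟨s, hs1, hs2⟩ := (hev.and (eventually_ge_atTop (max (-t) 1))).exists
  have hs_pos : 0 < s := lt_of_lt_of_le one_pos (le_trans (le_max_right _ _) hs2)
  have ht0 : -s ≤ t := by linarith [le_trans (le_max_left _ _) hs2]
  obtain ⟨T₀, hP₀, hT₀⟩ := hG (-s) t ht0 ht T hP
  have hfloor := hY (-s) (by linarith) T₀ hP₀
  rw [neg_neg] at hfloor hT₀
  have hmt : 0 < -t := by linarith
  have hsplit : s ^ ((3 : ℝ) / 2) = s ^ ((3 : ℝ) / 2 - κ) * s ^ κ := by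
    rw [← Real.rpow_add hs_pos]; ring_nf
  have hdiv : (s / -t) ^ κ = s ^ κ / (-t) ^ κ := Real.div_rpow hs_pos.le hmt.le κ
  have hsk : 0 < s ^ κ := Real.rpow_pos_of_pos hs_pos κ
  have htk : 0 < (-t) ^ κ := Real.rpow_pos_of_pos hmt κ
  have hchain : c₀ * (s ^ ((3 : ℝ) / 2 - κ) * s ^ κ) ≤ A * T * (s ^ κ / (-t) ^ κ) := by
    rw [← hsplit, ← hdiv]; exact le_trans hfloor hT₀
  have hchain' : c₀ * s ^ ((3 : ℝ) / 2 - κ) ≤ B := by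
    rw [hB]
    have := div_le_div_of_nonneg_right hchain hsk.le
    have e1 : c₀ * (s ^ ((3 : ℝ) / 2 - κ) * s ^ κ) / s ^ κ = c₀ * s ^ ((3 : ℝ) / 2 - κ) := by
      field_simp
    have e2 : A * T * (s ^ κ / (-t) ^ κ) / s ^ κ = A * T / (-t) ^ κ := by
      field_simp
    rw [e1, e2] at this; exact this
  have : B + c₀ ≤ c₀ * s ^ ((3 : ℝ) / 2 - κ) := by
    have := mul_le_mul_of_nonneg_left hs1 hc₀.le
    rw [mul_add, mul_one, mul_div_cancel₀ _ hc₀.ne'] at this; exact this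
  linarith

/-- **`NoLoopsOfGrowth` (stmt-NavierStokesRegularity-27894).**  The frequency growth exponent and the period scaling bound together
exclude closed vortex lines carrying vorticity in e₃-poloidal Type-I Oseen-mild ancient profiles: every periodic orbit of
`y′ = curl v(s)(y)` with a positive period is stationary. -/
theorem noLoopsOfGrowth_proof : NoLoopsOfGrowth := by
  unfold NoLoopsOfGrowth
  intro hG hB C v hrate hcont hmild hdiv hpol s hs γ ℓ hℓ hγ hper
  by_contra hne
  obtain ⟨M, hM⟩ := hB C
  -- the Yorke × Type-I period floor `c₀ (−t)^{3/2} ≤ T`, `c₀ = 1 / max M 1`, for non-stationary periodic vortex lines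
  set M' : ℝ := max M 1 with hM'
  have hM'pos : 0 < M' := lt_of_lt_of_le one_pos (le_max_right _ _)
  have hY : ∀ t < 0, ∀ (c : ℝ → EuclideanSpace ℝ (Fin 3)) (T : ℝ), 0 < T → Function.Periodic c T →
      (∀ θ, HasDerivAt c (Literature.Analysis.FluidPDE.curl (v t) (c θ)) θ) →
      (∃ θ, Literature.Analysis.FluidPDE.curl (v t) (c θ) ≠ 0) → (1 / M') * (-t) ^ ((3 : ℝ) / 2) ≤ T := by
    intro t ht c T hT hperc hderc hnz
    obtain ⟨θ₀, hθ₀⟩ := hnz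
    -- re-base the orbit at the non-stationary point
    have hc' : ∀ θ, HasDerivAt (fun θ => c (θ + θ₀)) (Literature.Analysis.FluidPDE.curl (v t) (c (θ + θ₀))) θ :=
      fun θ => HasDerivAt.comp_add_const θ θ₀ (hderc (θ + θ₀))
    have hc'per : ∀ θ, (fun θ => c (θ + θ₀)) (θ + T) = (fun θ => c (θ + θ₀)) θ := by
      intro θ; simp only; rw [show θ + T + θ₀ = θ + θ₀ + T by ring, hperc]
    have hc'0 : Literature.Analysis.FluidPDE.curl (v t) ((fun θ => c (θ + θ₀)) 0) ≠ 0 := by simpa using hθ₀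
    have key := hM v hrate hcont hmild hdiv t ht (fun θ => c (θ + θ₀)) T hT hc' hc'per hc'0
    -- key : T⁻¹ ≤ M (−t)^{−3/2}
    have hmt : 0 < (-t) ^ ((3 : ℝ) / 2) := Real.rpow_pos_of_pos (by linarith) _
    have hneg : (-t) ^ (-(3 : ℝ) / 2) = ((-t) ^ ((3 : ℝ) / 2))⁻¹ := by
      rw [show (-(3 : ℝ) / 2) = -((3 : ℝ) / 2) by ring, Real.rpow_neg (by linarith)]
    rw [hneg] at key
    have key' : T⁻¹ ≤ M' * ((-t) ^ ((3 : ℝ) / 2))⁻¹ :=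
      le_trans key (mul_le_mul_of_nonneg_right (le_max_left _ _) (inv_nonneg.2 hmt.le))
    rw [← div_eq_mul_inv, le_div_iff₀ hmt] at key'
    rw [div_mul_eq_mul_div, div_le_iff₀ hM'pos, one_mul]
    have hTinv : 0 < T⁻¹ := inv_pos.2 hT
    have : (-t) ^ ((3 : ℝ) / 2) ≤ M' / T⁻¹ := by rw [le_div_iff₀ hTinv, mul_comm]; exact key'
    rw [div_inv_eq_mul] at this
    linarith [mul_comm M' T]
  obtain ⟨A, κ, hA, hκ, hG'⟩ := hG C v hrate hcont hmild hdiv hpol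
  have key := noOrbit_of_floor_and_growth
    (P := fun t T => 0 < T ∧ ∃ c : ℝ → EuclideanSpace ℝ (Fin 3), Function.Periodic c T ∧
      (∀ θ, HasDerivAt c (Literature.Analysis.FluidPDE.curl (v t) (c θ)) θ) ∧
      ∃ θ, Literature.Analysis.FluidPDE.curl (v t) (c θ) ≠ 0)
    (1 / M') A κ (by positivity) hA hκ
    (fun t ht T hP => by
      obtain ⟨hT, c, hperc, hderc, hnz⟩ := hP
      exact hY t ht c T hT hperc hderc hnz)
    (fun t₀ t ht₀ ht T hP => by
      obtain ⟨hT, c, hperc, hderc, hnz⟩ := hP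
      obtain ⟨c', T₀, hT₀, hper', hder', hnz', hle⟩ := hG' t₀ t ht₀ ht c T hT hperc hderc hnz
      exact ⟨T₀, ⟨hT₀, c', hper', hder', hnz'⟩, hle⟩)
    s hs ℓ
  exact key ⟨hℓ, γ, hper, hγ, 0, hne⟩

end Summit.NavierStokesRegularity.NavierStokesRegularity.Theorems.LoopPeriodRatchetNoLoopsOfGrowth

end
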